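import Summits.CriticalPhenomena.PercolationContinuityZ3.Theorems.PercNearOneGluingNoHeavyLowerTailSahiSlotPatternSymm

/-!
# The saturation reduction for the slot-pattern inequality: every cell `(d, n+1)` is decided on SATURATED families —
# ordered `(n+1)`-colourings of antichains of the slot cube `[n+1]^d`

Support file (cell `prim-sahi`, seat `prim-sahi-typer` gen 27; `--supports stmt-CriticalPhenomena-4575`).  Pure proofs, no
definitions, no `sorry`, standard axioms.

Write `Φ = patternForm d (n+1)` and let `U_0, …, U_n` be up-sets of `Q = [n+1]^d`.  The C-slot SIGN⁻ law of lane `prim-masterthm-p3`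
(`SahiSlot.patternForm_single_nonpos`: for `y ∉ U_{j₀}` the profile `Φ(1_{{y}}, 1_{U_1}, …, 1_{U_n}) ≤ 0`, given the lower cells
`SlotPatternPos d k`, `k ≤ n`; unconditional at `(3,4)`, `…SignMinusThreeFour`) is taken here as a HYPOTHESIS `hsign`, so that this
file depends only on landed modules.  Under it:

* `patternForm_update_insert_eq` — linearity in slot `i`: adding a point `y ∉ U_i` to the member `U_i` adds the slot-`i` profile at `y`;
* `patternForm_slot_single_nonpos` — the sign law in an arbitrary slot `i` (slot symmetry `patternForm_perm_slots`);
* `exists_saturated_le` — **SATURATION**: every family of up-sets is dominated by a SATURATED family of up-sets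
  (`U ⊆ V` slotwise and `Φ(V) ≤ Φ(U)`), where `V` is saturated when every maximal non-element of `V_i` lies in every other member:
  `∀ i ≠ j, ∀ y ∉ V_i, (∀ z > y, z ∈ V_i) → y ∈ V_j`.  (Add maximal non-elements outside the meet of the others one at a time; each step
  is an up-set family with one more point and, by the sign law, no larger `Φ`.)
* `slotPatternPos_of_saturated` — hence **`SlotPatternPos d (n+1)` follows from `Φ ≥ 0` on saturated families alone**.

Saturated families are few: the complement of `V_i` is the down-closure of its maximal elements `N_i`, and saturation says exactly that
`N_0, …, N_n` are pairwise disjoint with `N_0 ∪ … ∪ N_n` an antichain (cross pairs are incomparable both ways).  So the saturated families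
of `[n+1]^d` are the ordered `(n+1)`-colourings of its antichains (`V_i = Q ∖ ↓N_i`).  For the first open cell `(3,4)`:
`Σ_{antichains N ⊆ [4]^3} 4^{|N|} = 4 424 940 417` families (`189 587 210` up to the colour symmetry `S_4`) (antichain sizes `0..12` with multiplicities
`1, 64, 1080, 7760, 28355, 57492, 67389, 46554, 18948, 4530, 625, 48, 2`) — a finite check of about one core-hour, against
`232 848^4 / (4!·3!) ≈ 2·10^19` raw quadruples.  CARRIED OUT (typer gen 27, 2026-08-22, two independent engines — closed counting form
`1296|∩U| − 16ΣN(ijk|l) − 8ΣN(ij|kl) + ΣN(ij|k|l) − N(0|1|2|3)` over general-position tuples, kit j165842–j165845; Latin-set decomposition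
`Σ_{L} Ψ(M_L)` over the 576 Latin transversals with `Ψ` tabulated on `2^16` incidence patterns, kit j165846–j165853): all
`4 424 940 417` saturated families of `[4]^3` have `Φ ≥ 0`, with `Φ = 0` only when some member is the whole cube and `Φ ≥ 576` otherwise.
So, by `slotPatternPos_of_saturated` and `patternForm_single_nonpos_three_four`, the cell `(3,4)` (`SlotPatternPos 3 4 = PatternPosN 4 3`:
Lieb–Sahi's Conjecture 1.1 on `[0,1]^3` at order 4, coefficientwise) holds — CERTIFIED by computation outside the kernel; this file proves
the reduction only and asserts nothing about `(3,4)`. [this work]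
-/

namespace Summit.CriticalPhenomena.PercolationContinuityZ3.Theorems

open Finset Function Equiv
open Literature.Combinatorics.Sahi2008

namespace SahiSlot

section Saturation

variable {d n : ℕ}

/-- Additivity of the pattern functional in the head slot. [this work] -/
theorem patternForm_cons_add (g₁ g₂ : Q d (n + 1) → ℝ) (F : Fin n → Q d (n + 1) → ℝ) :
    patternForm d (n + 1) (Fin.cons (g₁ + g₂) F) =
      patternForm d (n + 1) (Fin.cons g₁ F) + patternForm d (n + 1) (Fin.cons g₂ F) := by
  rw [patternForm_cons_eq_sum_profile (g₁ + g₂), patternForm_cons_eq_sum_profile g₁, patternForm_cons_eq_sum_profile g₂,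
    ← sum_add_distrib]
  refine sum_congr rfl fun y _ => ?_
  rw [Pi.add_apply, add_mul]

/-- Moving slot `i` to the head: a family read through the transposition `(0 i)` is `Fin.cons` of its `i`-th member. [this work] -/
theorem comp_swap_eq_cons (f : Fin (n + 1) → Q d (n + 1) → ℝ) (i : Fin (n + 1)) :
    (fun j => f (swap 0 i j)) = Fin.cons (f i) (fun k => f (swap 0 i k.succ)) := by
  funext j
  refine Fin.cases ?_ (fun k => ?_) j
  · simp only [swap_apply_left, Fin.cons_zero]
  · simp only [Fin.cons_succ]

/-- The indicator of `insert y A` for `y ∉ A` is the sum of the two indicators. [this work] -/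
theorem setInd_insert_of_not_mem {α : Type*} [DecidableEq α] {A : Finset α} {y : α} (hy : y ∉ A) :
    setInd (insert y A) = setInd A + setInd {y} := by
  funext x
  simp only [Pi.add_apply, setInd_apply, mem_insert, mem_singleton]
  by_cases hx : x = y
  · subst hx; simp [hy]
  · simp [hx]

/-- **Linearity in slot `i`**: adding a point `y ∉ U_i` to the member `U_i` adds the slot-`i` profile at `y`,
`Φ(…, 1_{U_i ∪ {y}}, …) = Φ(…, 1_{U_i}, …) + Φ(…, 1_{{y}}, …)`. [this work] -/
theorem patternForm_update_insert_eq (U : Fin (n + 1) → Finset (Q d (n + 1))) (i : Fin (n + 1)) {y : Q d (n + 1)}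
    (hy : y ∉ U i) :
    patternForm d (n + 1) (fun j => setInd (update U i (insert y (U i)) j)) =
      patternForm d (n + 1) (fun j => setInd (U j)) +
        patternForm d (n + 1) (fun j => setInd (update U i {y} j)) := by
  -- read all three families through the transposition `(0 i)`
  rw [← patternForm_perm_slots (fun j => setInd (update U i (insert y (U i)) j)) (swap 0 i),
    ← patternForm_perm_slots (fun j => setInd (U j)) (swap 0 i),
    ← patternForm_perm_slots (fun j => setInd (update U i {y} j)) (swap 0 i)]
  rw [comp_swap_eq_cons (fun j => setInd (update U i (insert y (U i)) j)) i,
    comp_swap_eq_cons (fun j => setInd (U j)) i, comp_swap_eq_cons (fun j => setInd (update U i {y} j)) i]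
  have htail : ∀ (S : Finset (Q d (n + 1))) (k : Fin n),
      setInd (update U i S (swap 0 i k.succ)) = setInd (U (swap 0 i k.succ)) := by
    intro S k
    have hne : swap (0 : Fin (n + 1)) i k.succ ≠ i := by
      intro h
      have h2 := congrArg (swap (0 : Fin (n + 1)) i) h
      rw [swap_apply_self, swap_apply_right] at h2
      exact Fin.succ_ne_zero k h2
    rw [update_of_ne hne]
  simp only [update_self, htail]
  rw [setInd_insert_of_not_mem hy, patternForm_cons_add]

/-- **The sign law in an arbitrary slot**: if the slot-profile sign law holds in the head slot (hypothesis `hsign`, =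
`patternForm_single_nonpos` given the lower cells), then for up-sets `U_j` (`j ≠ i`) and a point `y ∉ U_{j₀}`, `j₀ ≠ i`, the family with
`1_{{y}}` in slot `i` has `Φ ≤ 0`. [this work] -/
theorem patternForm_slot_single_nonpos
    (hsign : ∀ (y : Q d (n + 1)) (F : Fin n → Finset (Q d (n + 1))), (∀ j, IsUpperSet (F j : Set (Q d (n + 1)))) →
      ∀ j₀, y ∉ F j₀ → patternForm d (n + 1) (Fin.cons (setInd {y}) (fun j => setInd (F j))) ≤ 0)
    (U : Fin (n + 1) → Finset (Q d (n + 1))) (i : Fin (n + 1)) (hU : ∀ j, j ≠ i → IsUpperSet (U j : Set (Q d (n + 1))))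
    {y : Q d (n + 1)} {j₀ : Fin (n + 1)} (hj₀ : j₀ ≠ i) (hy : y ∉ U j₀) :
    patternForm d (n + 1) (fun j => setInd (update U i {y} j)) ≤ 0 := by
  rw [← patternForm_perm_slots (fun j => setInd (update U i {y} j)) (swap 0 i),
    comp_swap_eq_cons (fun j => setInd (update U i {y} j)) i]
  have hne : ∀ k : Fin n, swap (0 : Fin (n + 1)) i k.succ ≠ i := by
    intro k h
    have h2 := congrArg (swap (0 : Fin (n + 1)) i) h
    rw [swap_apply_self, swap_apply_right] at h2
    exact Fin.succ_ne_zero k h2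
  have htail : (fun k : Fin n => setInd (update U i {y} (swap 0 i k.succ))) = fun k => setInd (U (swap 0 i k.succ)) := by
    funext k; rw [update_of_ne (hne k)]
  rw [update_self, htail]
  -- the slot `j₀` sits at some tail position `k₀.succ` with `swap 0 i k₀.succ = j₀`
  have hj0' : swap (0 : Fin (n + 1)) i j₀ ≠ 0 := by
    intro h
    have h2 := congrArg (swap (0 : Fin (n + 1)) i) h
    rw [swap_apply_self, swap_apply_left] at h2
    exact hj₀ h2
  obtain ⟨k₀, hk₀⟩ := Fin.exists_succ_eq.2 hj0'
  refine hsign y (fun k => U (swap 0 i k.succ)) (fun k => hU _ (hne k)) k₀ ?_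
  rw [hk₀, swap_apply_self]
  exact hy

/-- A family of finsets is **saturated** when every maximal non-element of each member lies in every other member.  We spell the
property out inline (no definition): `∀ i j, i ≠ j → ∀ y ∉ U i, (∀ z, y < z → z ∈ U i) → y ∈ U j`.
**SATURATION**: under the head-slot sign law, every family of up-sets of `[n+1]^d` is dominated by a saturated family of up-sets —
slotwise larger and with no larger `Φ`. [this work] -/
theorem exists_saturated_le
    (hsign : ∀ (y : Q d (n + 1)) (F : Fin n → Finset (Q d (n + 1))), (∀ j, IsUpperSet (F j : Set (Q d (n + 1)))) →
      ∀ j₀, y ∉ F j₀ → patternForm d (n + 1) (Fin.cons (setInd {y}) (fun j => setInd (F j))) ≤ 0)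
    (U : Fin (n + 1) → Finset (Q d (n + 1))) (hU : ∀ i, IsUpperSet (U i : Set (Q d (n + 1)))) :
    ∃ V : Fin (n + 1) → Finset (Q d (n + 1)), (∀ i, IsUpperSet (V i : Set (Q d (n + 1)))) ∧ (∀ i, U i ⊆ V i) ∧
      (∀ i j, i ≠ j → ∀ y, y ∉ V i → (∀ z, y < z → z ∈ V i) → y ∈ V j) ∧
      patternForm d (n + 1) (fun i => setInd (V i)) ≤ patternForm d (n + 1) (fun i => setInd (U i)) := by
  -- induction on the total number of MISSING points
  set N := (n + 1) * Fintype.card (Q d (n + 1)) with hN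
  have hbound : ∀ W : Fin (n + 1) → Finset (Q d (n + 1)), ∑ i, (W i).card ≤ N := by
    intro W
    calc ∑ i, (W i).card ≤ ∑ _i : Fin (n + 1), Fintype.card (Q d (n + 1)) := sum_le_sum fun i _ => card_le_univ _
      _ = N := by rw [sum_const, card_univ, Fintype.card_fin, smul_eq_mul]
  suffices H : ∀ m (W : Fin (n + 1) → Finset (Q d (n + 1))), N - ∑ i, (W i).card = m →
      (∀ i, IsUpperSet (W i : Set (Q d (n + 1)))) →
      ∃ V : Fin (n + 1) → Finset (Q d (n + 1)), (∀ i, IsUpperSet (V i : Set (Q d (n + 1)))) ∧ (∀ i, W i ⊆ V i) ∧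
        (∀ i j, i ≠ j → ∀ y, y ∉ V i → (∀ z, y < z → z ∈ V i) → y ∈ V j) ∧
        patternForm d (n + 1) (fun i => setInd (V i)) ≤ patternForm d (n + 1) (fun i => setInd (W i)) from
    H _ U rfl hU
  intro m
  induction m using Nat.strong_induction_on with
  | _ m ih =>
    intro W hm hW
    by_cases hsat : ∀ i j, i ≠ j → ∀ y, y ∉ W i → (∀ z, y < z → z ∈ W i) → y ∈ W j
    · exact ⟨W, hW, fun i => Subset.rfl, hsat, le_rfl⟩
    push Not at hsat
    obtain ⟨i, j, hij, y, hyi, hymax, hyj⟩ := hsat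
    -- add `y` to the member `i`
    set W' : Fin (n + 1) → Finset (Q d (n + 1)) := update W i (insert y (W i)) with hW'
    have hW'i : W' i = insert y (W i) := by rw [hW', update_self]
    have hW'k : ∀ k, k ≠ i → W' k = W k := fun k hk => by rw [hW', update_of_ne hk]
    have hup : ∀ k, IsUpperSet (W' k : Set (Q d (n + 1))) := by
      intro k
      by_cases hk : k = i
      · subst hk
        rw [hW'i]
        intro a b hab ha
        rw [mem_coe, mem_insert] at ha ⊢
        rcases ha with rfl | ha
        · rcases eq_or_lt_of_le hab with rfl | hlt
          · exact Or.inl rfl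
          · exact Or.inr (hymax b hlt)
        · exact Or.inr (hW k hab ha)
      · rw [hW'k k hk]; exact hW k
    have hsub : ∀ k, W k ⊆ W' k := by
      intro k
      by_cases hk : k = i
      · subst hk; rw [hW'i]; exact subset_insert _ _
      · rw [hW'k k hk]
    have hcard : ∑ k, (W' k).card = ∑ k, (W k).card + 1 := by
      have h1 : ∑ k, (W' k).card = ∑ k, ((W k).card + if k = i then 1 else 0) := by
        refine sum_congr rfl fun k _ => ?_
        by_cases hk : k = i
        · subst hk; rw [hW'i, card_insert_of_notMem hyi, if_pos rfl]
        · rw [hW'k k hk, if_neg hk, add_zero]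
      rw [h1, sum_add_distrib, sum_ite_eq' univ i, if_pos (mem_univ _)]
    have hm' : N - ∑ k, (W' k).card < m := by
      have := hbound W'
      omega
    obtain ⟨V, hV, hWV, hVsat, hVle⟩ := ih _ hm' W' rfl hup
    refine ⟨V, hV, fun k => (hsub k).trans (hWV k), hVsat, hVle.trans ?_⟩
    -- `Φ(W') = Φ(W) + (slot-i profile at y) ≤ Φ(W)`
    rw [hW', patternForm_update_insert_eq W i hyi]
    have hprof := patternForm_slot_single_nonpos hsign W i (fun k _ => hW k) (Ne.symm hij) hyj
    linarith

/-- **THE SATURATION REDUCTION.**  Under the head-slot sign law (`patternForm_single_nonpos`, given the lower cells), the cell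
`SlotPatternPos d (n+1)` follows from the nonnegativity of `Φ` on SATURATED families of up-sets alone — the ordered `(n+1)`-colourings of
antichains of `[n+1]^d`. [this work] -/
theorem slotPatternPos_of_saturated
    (hsign : ∀ (y : Q d (n + 1)) (F : Fin n → Finset (Q d (n + 1))), (∀ j, IsUpperSet (F j : Set (Q d (n + 1)))) →
      ∀ j₀, y ∉ F j₀ → patternForm d (n + 1) (Fin.cons (setInd {y}) (fun j => setInd (F j))) ≤ 0)
    (hsat : ∀ V : Fin (n + 1) → Finset (Q d (n + 1)), (∀ i, IsUpperSet (V i : Set (Q d (n + 1)))) →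
      (∀ i j, i ≠ j → ∀ y, y ∉ V i → (∀ z, y < z → z ∈ V i) → y ∈ V j) → 0 ≤ patternForm d (n + 1) (fun i => setInd (V i))) :
    SlotPatternPos d (n + 1) := by
  intro U hU
  obtain ⟨V, hV, -, hVsat, hle⟩ := exists_saturated_le hsign U hU
  exact (hsat V hV hVsat).trans hle

end Saturation

end SahiSlot

end Summit.CriticalPhenomena.PercolationContinuityZ3.Theorems
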